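import Summits.AtomisticToContinuum.Crystallization.Theorems.ExcessDecayLiouvillePhononStabilityCertModel
import Summits.AtomisticToContinuum.Crystallization.Theorems.ExcessDecayLiouvillePhononStabilityCertFar

/-!
# Near-certificate layer VI: the generator chart, cell data and the validity of the class terms

Support file for crux `PhononStability` (line `contragredient-window-collapse`): the generator/dual-generator chart (`Ĝ`, `Ĥ`, `ζ̂`), the chart identities the target relies on (stated as one proposition, proved in a later file), cell data and the chart assignment of a datum, the bond-coordinate chart (v3: in-plane and inter-sublattice nearest-neighbour `Δρ` as variables, normalised strain entries, shift), the polynomial `Δρ_c` of every class, the polynomial matrix `ζ̂ζ̂ᵀ`, and the validity of the checked `ω` model term against the true class term. [folklore]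
-/

noncomputable section

open scoped BigOperators Classical InnerProductSpace
open Filter Set Function
open Summit.AtomisticToContinuum.Crystallization.Theorems.PhononStabilityNegative

namespace Summit.AtomisticToContinuum.Crystallization.Theorems.PhononStabilityCWC.Cert

local notation "E3" => EuclideanSpace ℝ (Fin 3)

/-! ## The chart identities, cell data and the chart assignment -/

/-- **CHART IDENTITIES** used by the target (wave-2 obligation; pure linear algebra in the generator chart). -/
def ChartIdentities : Prop :=
  (∀ (A : E3 →L[ℝ] E3) (δ : E3) (c : BondClass),
      ‖A (bondVec δ c)‖ ^ 2 = ∑ i, ∑ j, zhat c (contraOf δ) i * ghat A i j * zhat c (contraOf δ) j) ∧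
  (∀ (δ : E3) (c : BondClass), contraOf (bondVec δ c) = zhat c (contraOf δ)) ∧
  (∀ (v : E3) (s : BondClass) (w : Label → E3),
      (∑' k, (inner ℝ v (bondDiff s w k)) ^ 2) = pairEvalR s (fun i j => contraOf v i * contraOf v j) w) ∧
  (∀ (B : E3 →L[ℝ] E3) (c : BondClass) (w : Label → E3), metricForm B c w = pairEvalR c (hhat B) w) ∧
  (∀ (B : E3 →L[ℝ] E3) (c : BondClass) (w : Label → E3), 0 ≤ pairEvalR c (hhat B) w) ∧
  (∀ (c : BondClass) (w : Label → E3), plainForm c w = pairEvalR c (fun i j => (M0inv i j : ℝ)) w)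

/-- the longitudinal form as a pair form (from the chart identities). [folklore] -/
theorem longForm_eq_pairEvalR (hCI : ChartIdentities) (δ : E3) (c : BondClass) (w : Label → E3) :
    longForm δ c w = pairEvalR c (fun i j => zhat c (contraOf δ) i * zhat c (contraOf δ) j) w := by
  have h := hCI.2.2.1 (bondVec δ c) c w
  rw [hCI.2.1 δ c] at h
  rw [← h]
  rfl

/-! ## Cell data, variable numbering and the chart assignment (chart v3)

Variables: `1,2,3` the in-plane nearest-neighbour `Δρ` of `u=(1,0,0)`, `v=(0,1,0)`, `u−v` (`= X₁₁, X₂₂, X₁₁+X₂₂−2X₁₂`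
with `X = Ĝ − G_c`); `4,5,6` the entries `X̃₁₃, X̃₂₃, X̃₃₃` of `X̃ = Sᵀ X S` in the normalising frame `S`;
`7,8,9` the shift `δ̂ − d_c`; `10…15` the `Δρ` (shift included) of the six canonical inter-sublattice bonds. -/

/-- variable index of `δ̂ᵢ` -/
def vD (i : Fin 3) : ℕ := match i with | 0 => 7 | 1 => 8 | 2 => 9

/-- the six canonical inter-sublattice nearest-neighbour classes (up `ι+k'`, down `ι−e₃+k'`) -/
def interCls (k : Fin 6) : BondClass :=
  match k with
  | 0 => ((0 : Fin 2), (1 : Fin 2), ![0, 0, 0]) | 1 => (0, 1, ![-1, 0, 0]) | 2 => (0, 1, ![0, -1, 0])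
  | 3 => (0, 1, ![0, 0, -1]) | 4 => (0, 1, ![-1, 0, -1]) | 5 => (0, 1, ![0, -1, -1])

/-- the flipped class -/
def flipCls (c : BondClass) : BondClass := (c.2.1, c.1, -c.2.2)

/-- index of a class among the canonical inter bonds and their flips -/
def interIdx (c : BondClass) : Option (Fin 6) :=
  (List.finRange 6).find? fun k => decide (c = interCls k) || decide (c = flipCls (interCls k))

/-- cell centre data (all rational): centre of `Ĝ`, of `δ̂`, and the dual centre `H̃_c = (SᵀG_cS)⁻¹` in the frame `S` -/
structure CellData where
  /-- centre of `Ĝ` (symmetric; entries `i ≤ j` used) -/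
  Gc : Fin 3 → Fin 3 → ℚ
  /-- centre of `δ̂` -/
  dc : Fin 3 → ℚ
  /-- `(Sᵀ G_c S)⁻¹` (symmetric; checked by `invOK`) -/
  Htc : Fin 3 → Fin 3 → ℚ

namespace CellData
variable (C : CellData)
/-- symmetric access to the centre of `Ĝ` -/
def G (i j : Fin 3) : ℚ := if i ≤ j then C.Gc i j else C.Gc j i
/-- centre direction `z̄ = ζ̂⁰ + s δ̂_c` -/
def zbar (c : BondClass) (i : Fin 3) : ℚ := zhat0 c i + sdiff c * C.dc i
/-- centre of `ρ_c`: `z̄ᵀ G_c z̄` -/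
def rhoc (c : BondClass) : ℚ := ∑ i, ∑ j, C.zbar c i * C.G i j * C.zbar c j
end CellData

/-- symmetric access is symmetric. [folklore] -/
theorem CellData.G_symm (C : CellData) (i j : Fin 3) : C.G i j = C.G j i := by
  unfold CellData.G
  split_ifs with h1 h2 h2
  · have : i = j := le_antisymm h1 h2
    subst this; rfl
  · rfl
  · rfl
  · exfalso; exact h1 (le_of_not_ge h2)

/-- the strain deviation `X = Ĝ − G_c` as a matrix of linear polynomials in the variables `1…6`
(`X₁₃ = (80/49) x₄`, `X₂₃ = (40/49) x₄ + (70/49) x₅`, `X₃₃ = (6400/2401) x₆`). -/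
def XP : Fin 3 → Fin 3 → SPoly := fun i j =>
  match i, j with
  | 0, 0 => [([1], 1)]
  | 1, 1 => [([2], 1)]
  | 0, 1 => [([1], 1 / 2), ([2], 1 / 2), ([3], -1 / 2)]
  | 1, 0 => [([1], 1 / 2), ([2], 1 / 2), ([3], -1 / 2)]
  | 0, 2 => [([4], 80 / 49)]
  | 2, 0 => [([4], 80 / 49)]
  | 1, 2 => [([4], 40 / 49), ([5], 70 / 49)]
  | 2, 1 => [([4], 40 / 49), ([5], 70 / 49)]
  | 2, 2 => [([6], 6400 / 2401)]

/-- the chart assignment of a datum relative to a cell centre -/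
def chartX (C : CellData) (A _B : E3 →L[ℝ] E3) (δ : E3) (v : ℕ) : ℝ :=
  let X : Fin 3 → Fin 3 → ℝ := fun i j => ghat A i j - C.G i j
  let d := contraOf δ
  if 1 ≤ v ∧ v ≤ 15 then
    match v with
    | 1 => X 0 0 | 2 => X 1 1 | 3 => X 0 0 + X 1 1 - 2 * X 0 1
    | 4 => 49 / 80 * X 0 2 | 5 => 49 / 80 * (-(4 / 7) * X 0 2 + 8 / 7 * X 1 2) | 6 => (49 / 80) ^ 2 * X 2 2
    | 7 => d 0 - C.dc 0 | 8 => d 1 - C.dc 1 | 9 => d 2 - C.dc 2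
    | 10 => ‖A (bondVec δ (interCls 0))‖ ^ 2 - C.rhoc (interCls 0)
    | 11 => ‖A (bondVec δ (interCls 1))‖ ^ 2 - C.rhoc (interCls 1)
    | 12 => ‖A (bondVec δ (interCls 2))‖ ^ 2 - C.rhoc (interCls 2)
    | 13 => ‖A (bondVec δ (interCls 3))‖ ^ 2 - C.rhoc (interCls 3)
    | 14 => ‖A (bondVec δ (interCls 4))‖ ^ 2 - C.rhoc (interCls 4)
    | _ => ‖A (bondVec δ (interCls 5))‖ ^ 2 - C.rhoc (interCls 5)
  else 0

/-- **`X(x) = Ĝ − G_c` at the chart assignment.** [folklore] -/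
theorem matVal_XP (C : CellData) (A B : E3 →L[ℝ] E3) (δ : E3) (i j : Fin 3) :
    spEval (XP i j) (chartX C A B δ) = ghat A i j - C.G i j := by
  have e1 : chartX C A B δ 1 = ghat A 0 0 - C.G 0 0 := by simp [chartX]
  have e2 : chartX C A B δ 2 = ghat A 1 1 - C.G 1 1 := by simp [chartX]
  have e3' : chartX C A B δ 3 = (ghat A 0 0 - C.G 0 0) + (ghat A 1 1 - C.G 1 1) - 2 * (ghat A 0 1 - C.G 0 1) := by
    simp [chartX]
  have e4 : chartX C A B δ 4 = 49 / 80 * (ghat A 0 2 - C.G 0 2) := by simp [chartX]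
  have e5 : chartX C A B δ 5 = 49 / 80 * (-(4 / 7) * (ghat A 0 2 - C.G 0 2) + 8 / 7 * (ghat A 1 2 - C.G 1 2)) := by
    simp [chartX]
  have e6 : chartX C A B δ 6 = (49 / 80) ^ 2 * (ghat A 2 2 - C.G 2 2) := by simp [chartX]
  fin_cases i <;> fin_cases j <;>
    simp only [XP, spEval, monoVal, List.map_cons, List.map_nil, List.sum_cons, List.sum_nil, List.prod_cons,
      List.prod_nil, Fin.isValue, Fin.mk_one, Fin.zero_eta, Fin.reduceFinMk, e1, e2, e3', e4, e5, e6,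
      ghat_symm A 1 0, ghat_symm A 2 0, ghat_symm A 2 1, C.G_symm 1 0, C.G_symm 2 0, C.G_symm 2 1] <;>
    push_cast <;> ring

/-- the direction `ẑ = z̄ + s (δ̂ − d_c)` as a vector of linear polynomials -/
def zP (C : CellData) (c : BondClass) (i : Fin 3) : SPoly := [([], C.zbar c i), ([vD i], sdiff c)]

/-- `ẑ(x)` at the chart assignment. [folklore] -/
theorem spEval_zP (C : CellData) (A B : E3 →L[ℝ] E3) (δ : E3) (c : BondClass) (i : Fin 3) :
    spEval (zP C c i) (chartX C A B δ) = zhat c (contraOf δ) i := by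
  have e7 : chartX C A B δ 7 = contraOf δ 0 - C.dc 0 := by simp [chartX]
  have e8 : chartX C A B δ 8 = contraOf δ 1 - C.dc 1 := by simp [chartX]
  have e9 : chartX C A B δ 9 = contraOf δ 2 - C.dc 2 := by simp [chartX]
  fin_cases i <;>
    simp only [zP, vD, spEval, monoVal, zhat, CellData.zbar, List.map_cons, List.map_nil, List.sum_cons, List.sum_nil,
      List.prod_cons, List.prod_nil, Fin.isValue, Fin.mk_one, Fin.zero_eta, Fin.reduceFinMk, e7, e8, e9] <;>
    push_cast <;> ring

/-- the generic polynomial `Δρ_c(x) = ẑᵀ (G_c + X) ẑ − ρ̄_c` (degree ≤ 3) -/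
def rhoPolyGen (C : CellData) (c : BondClass) : SPoly :=
  spNorm ((List.finRange 3).flatMap fun i => (List.finRange 3).flatMap fun j =>
    spMul (zP C c i) (spMul (([], C.G i j) :: XP i j) (zP C c j))) ++ [([], -C.rhoc c)]

/-- **the polynomial `Δρ_c(x)`:** a single variable for the canonical inter bonds and their flips, generic otherwise. -/
def rhoPoly (C : CellData) (c : BondClass) : SPoly :=
  match interIdx c with
  | some k => [([10 + k.val], 1)]
  | none => rhoPolyGen C c

/-- evaluation of the generic polynomial. [folklore] -/
theorem spEval_rhoPolyGen (hCI : ChartIdentities) (C : CellData) (A B : E3 →L[ℝ] E3) (δ : E3) (c : BondClass) :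
    spEval (rhoPolyGen C c) (chartX C A B δ) = ‖A (bondVec δ c)‖ ^ 2 - C.rhoc c := by
  unfold rhoPolyGen
  rw [spEval_append, spEval_spNorm, hCI.1 A δ c]
  have hflat : ∀ (L : List (Fin 3)) (f : Fin 3 → SPoly) (x : ℕ → ℝ),
      spEval (L.flatMap f) x = (L.map fun i => spEval (f i) x).sum := by
    intro L f x; induction L with
    | nil => rfl
    | cons a rest ih => rw [List.flatMap_cons, spEval_append, ih, List.map_cons, List.sum_cons]
  rw [hflat, ← List.ofFn_eq_map, List.sum_ofFn]
  have h1 : monoVal (chartX C A B δ) [] = 1 := by simp [monoVal]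
  simp only [hflat, ← List.ofFn_eq_map, List.sum_ofFn, spEval_spMul, spEval_cons, spEval_nil, matVal_XP, spEval_zP, h1,
    one_mul, add_zero]
  push_cast
  simp only [Fin.sum_univ_three]
  ring

/-- the flipped bond vector is the negative. [folklore] -/
theorem bondVec_flipCls (δ : E3) (c : BondClass) : bondVec δ (flipCls c) = -bondVec δ c := by
  obtain ⟨m, m', n⟩ := c
  simp only [flipCls, bondVec, refPos, latVec, Pi.neg_apply, Int.cast_neg, neg_smul, Pi.zero_apply, Int.cast_zero,
    zero_smul, zero_add]
  fin_cases m <;> fin_cases m' <;> simp <;> abel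

/-- `z̄` of the flipped class is the negative. [folklore] -/
theorem zbar_flipCls (C : CellData) (c : BondClass) (i : Fin 3) : C.zbar (flipCls c) i = -C.zbar c i := by
  obtain ⟨m, m', n⟩ := c
  simp only [CellData.zbar, zhat0, sdiff, flipCls, Pi.neg_apply, Int.cast_neg, zhat0.subSignQ]
  fin_cases m <;> fin_cases m' <;> simp <;> ring

/-- `ρ̄` of the flipped class is the same. [folklore] -/
theorem rhoc_flipCls (C : CellData) (c : BondClass) : C.rhoc (flipCls c) = C.rhoc c := by
  simp only [CellData.rhoc, zbar_flipCls]
  refine Finset.sum_congr rfl fun i _ => Finset.sum_congr rfl fun j _ => ?_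
  ring

/-- **The squared bond length in the chart:** `‖A ζ_c(δ)‖² = ρ̄_c + Δρ_c(x)` with `x` the chart assignment. -/
theorem rho_eq (hCI : ChartIdentities) (C : CellData) (A B : E3 →L[ℝ] E3) (δ : E3) (c : BondClass) :
    ‖A (bondVec δ c)‖ ^ 2 = (C.rhoc c : ℝ) + spEval (rhoPoly C c) (chartX C A B δ) := by
  unfold rhoPoly
  split
  · rename_i k hk
    -- `c` is the canonical inter bond `k` or its flip
    have hx : spEval [([10 + k.val], (1 : ℚ))] (chartX C A B δ) =
        ‖A (bondVec δ (interCls k))‖ ^ 2 - C.rhoc (interCls k) := by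
      fin_cases k <;> simp [spEval, monoVal, chartX]
    rw [hx]
    unfold interIdx at hk
    have hmem := List.find?_some hk
    simp only [Bool.or_eq_true, decide_eq_true_eq] at hmem
    rcases hmem with h | h
    · subst h; ring
    · subst h; rw [bondVec_flipCls, map_neg, norm_neg, rhoc_flipCls]; ring
  · rw [spEval_rhoPolyGen hCI]; ring

/-! ## The geometric polynomial matrix of a class: `ζ̂ζ̂ᵀ` (in the shift variables) -/

/-- unit vector -/
def e3 (j : Fin 3) : Fin 3 → ℚ := fun i => if i = j then 1 else 0

/-- the polynomial matrix `ζ̂ζ̂ᵀ = (z̄ + sΔd)(z̄ + sΔd)ᵀ` -/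
def LmatP (C : CellData) (c : BondClass) : List (Mono × Mat) :=
  let z := C.zbar c
  let s := sdiff c
  [([], fun i j => z i * z j),
    ([7], fun i j => s * (z i * e3 0 j + e3 0 i * z j)), ([8], fun i j => s * (z i * e3 1 j + e3 1 i * z j)),
    ([9], fun i j => s * (z i * e3 2 j + e3 2 i * z j)),
    ([7, 7], fun i j => s ^ 2 * (e3 0 i * e3 0 j)), ([8, 8], fun i j => s ^ 2 * (e3 1 i * e3 1 j)),
    ([9, 9], fun i j => s ^ 2 * (e3 2 i * e3 2 j)),
    ([7, 8], fun i j => s ^ 2 * (e3 0 i * e3 1 j + e3 1 i * e3 0 j)),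
    ([7, 9], fun i j => s ^ 2 * (e3 0 i * e3 2 j + e3 2 i * e3 0 j)),
    ([8, 9], fun i j => s ^ 2 * (e3 1 i * e3 2 j + e3 2 i * e3 1 j))]

/-- `ζ̂ζ̂ᵀ(x) = ζ̂(δ̂) ζ̂(δ̂)ᵀ` at the chart assignment -/
theorem matVal_LmatP (C : CellData) (A B : E3 →L[ℝ] E3) (δ : E3) (c : BondClass) :
    matVal (chartX C A B δ) (LmatP C c) = fun i j => zhat c (contraOf δ) i * zhat c (contraOf δ) j := by
  have e7 : chartX C A B δ 7 = contraOf δ 0 - C.dc 0 := by simp [chartX]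
  have e8 : chartX C A B δ 8 = contraOf δ 1 - C.dc 1 := by simp [chartX]
  have e9 : chartX C A B δ 9 = contraOf δ 2 - C.dc 2 := by simp [chartX]
  funext i j
  simp only [matVal, LmatP, CellData.zbar, zhat, monoVal, List.map_cons, List.map_nil, List.sum_cons, List.sum_nil,
    List.prod_cons, List.prod_nil, e7, e8, e9, e3]
  fin_cases i <;> fin_cases j <;> simp <;> ring


/-! ## Per-class model terms and their validity -/

/-- the ω-term of a class: `Pω(Δρ_c(x)) · pair(c, ζ̂ζ̂ᵀ(x))` -/
def omegaTermPPF (C : CellData) (c : BondClass) (P : UPoly) : PolyPF :=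
  mulSP (ucompose P (rhoPoly C c)) (classPPF c (LmatP C c))

/-! ## The geometric range of a class's squared bond length on the window (model-check radius) -/

/-- rational lower bound of the reference length `‖ζ⁰_c‖ = √Q/6` -/
def lloQ (Q : ℤ) : ℚ := (Nat.sqrt (Q.toNat * 1000000) : ℚ) / 6000
/-- rational upper bound of the reference length -/
def lupQ (Q : ℤ) : ℚ := ((Nat.sqrt (Q.toNat * 1000000) + 1 : ℕ) : ℚ) / 6000
/-- **the geometric radius** `h_c ≥ |‖Aζ_c(δ)‖² − ρ̄_c|` on the window:
`max(hi·(ℓ⁺ + 5/189)² − ρ̄, ρ̄ − lo·(ℓ⁻ − 5/189)²)` with `lo = (189/200)²`, `hi = (199/200)²` -/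
def hGeom (Q : ℤ) (ρbar : ℚ) : ℚ :=
  max ((199 / 200) ^ 2 * (lupQ Q + 5 / 189) ^ 2 - ρbar) (ρbar - (189 / 200) ^ 2 * (lloQ Q - 5 / 189) ^ 2)

/-- `ℓ⁻ ≤ ‖ζ⁰_c‖ ≤ ℓ⁺`. [folklore] -/
theorem llo_le_norm_le_lup (c : BondClass) :
    (lloQ (Qint c) : ℝ) ≤ ‖bondVec 0 c‖ ∧ ‖bondVec 0 c‖ ≤ (lupQ (Qint c) : ℝ) := by
  have hq := qint_cast c
  have hQ0 : 0 ≤ Qint c := by unfold Qint; positivity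
  have hQn : (((Qint c).toNat : ℕ) : ℝ) = ((Qint c : ℤ) : ℝ) := by exact_mod_cast Int.toNat_of_nonneg hQ0
  set N := Nat.sqrt ((Qint c).toNat * 1000000) with hN
  have h1 : ((N ^ 2 : ℕ) : ℝ) ≤ (((Qint c).toNat * 1000000 : ℕ) : ℝ) := by exact_mod_cast Nat.sqrt_le' _
  have h2 : (((Qint c).toNat * 1000000 : ℕ) : ℝ) < (((N + 1) ^ 2 : ℕ) : ℝ) := by exact_mod_cast Nat.lt_succ_sqrt' _
  push_cast at h1 h2
  rw [hQn, hq] at h1 h2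
  have hn := norm_nonneg (bondVec 0 c)
  have hN0 : (0 : ℝ) ≤ N := by positivity
  constructor
  · unfold lloQ; push_cast; rw [← hN]
    rw [div_le_iff₀ (by norm_num)]
    nlinarith
  · unfold lupQ; push_cast; rw [← hN]
    rw [le_div_iff₀ (by norm_num)]
    nlinarith

/-- `‖ζ_c(δ)‖ ≤ ‖ζ⁰_c‖ + 5/189` on the window. [folklore] -/
theorem norm_bondVec_le {A : E3 →L[ℝ] E3} {δ : E3} (hW : CellWindow A) (hδ : ShiftWindow A δ) (c : BondClass) :
    ‖bondVec δ c‖ ≤ ‖bondVec 0 c‖ + 5 / 189 := by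
  have hε : ‖δ‖ ≤ 5 / 189 := by
    have h1 := (hW δ).1
    unfold ShiftWindow at hδ
    linarith
  have hs : |subSign c.2.1 - subSign c.1| ≤ 1 := by
    unfold subSign; split_ifs <;> norm_num
  have hb : ‖bondVec δ c - bondVec 0 c‖ ≤ ‖δ‖ := by
    rw [bondVec_eq δ c, add_sub_cancel_left, norm_smul, Real.norm_eq_abs]
    calc |subSign c.2.1 - subSign c.1| * ‖δ‖ ≤ 1 * ‖δ‖ := mul_le_mul_of_nonneg_right hs (norm_nonneg _)
      _ = ‖δ‖ := one_mul _
  have := norm_le_insert' (bondVec δ c) (bondVec 0 c)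
  linarith

/-- **the squared bond length stays within the geometric radius of its centre value.** [folklore] -/
theorem abs_rho_sub_le {A : E3 →L[ℝ] E3} {δ : E3} (hW : CellWindow A) (hδ : ShiftWindow A δ) (c : BondClass)
    (hQ : 36 ≤ Qint c) (ρbar : ℚ) :
    |‖A (bondVec δ c)‖ ^ 2 - ρbar| ≤ (hGeom (Qint c) ρbar : ℝ) := by
  obtain ⟨hlo, hup⟩ := llo_le_norm_le_lup c
  have hl1 : (1 : ℝ) ≤ lloQ (Qint c) := by
    -- `Nat.sqrt (Q·10⁶) ≥ 6000` for `Q ≥ 36`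
    have hQ0 : 0 ≤ Qint c := by unfold Qint; positivity
    have h36 : 36 * 1000000 ≤ (Qint c).toNat * 1000000 := by
      have : (36 : ℤ) ≤ ((Qint c).toNat : ℤ) := by rw [Int.toNat_of_nonneg hQ0]; exact hQ
      have : 36 ≤ (Qint c).toNat := by exact_mod_cast this
      omega
    have hs : 6000 ≤ Nat.sqrt ((Qint c).toNat * 1000000) := by
      rw [show (6000 : ℕ) = Nat.sqrt (36 * 1000000) by norm_num [Nat.sqrt_eq']] -- 36e6 = 6000²
      exact Nat.sqrt_le_sqrt h36
    unfold lloQ; push_cast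
    rw [le_div_iff₀ (by norm_num)]
    exact_mod_cast (show (6000 : ℕ) * 1 ≤ Nat.sqrt ((Qint c).toNat * 1000000) by simpa using hs)
  have hz1 := norm_bondVec_ge hW hδ c
  have hz2 := norm_bondVec_le hW hδ c
  have hA1 := (hW (bondVec δ c)).1
  have hA2 := (hW (bondVec δ c)).2
  set r := ‖A (bondVec δ c)‖
  set z := ‖bondVec δ c‖
  set l := ‖bondVec 0 c‖
  have hzlo : (189 / 200 : ℝ) * ((lloQ (Qint c) : ℝ) - 5 / 189) ≤ r := by nlinarith
  have hzlo0 : (0 : ℝ) ≤ (189 / 200 : ℝ) * ((lloQ (Qint c) : ℝ) - 5 / 189) := by nlinarith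
  have hzhi : r ≤ (199 / 200 : ℝ) * ((lupQ (Qint c) : ℝ) + 5 / 189) := by nlinarith
  have hr0 : 0 ≤ r := norm_nonneg _
  have hsq1 : ((189 / 200 : ℝ) * ((lloQ (Qint c) : ℝ) - 5 / 189)) ^ 2 ≤ r ^ 2 := pow_le_pow_left₀ hzlo0 hzlo 2
  have hsq2 : r ^ 2 ≤ ((199 / 200 : ℝ) * ((lupQ (Qint c) : ℝ) + 5 / 189)) ^ 2 := pow_le_pow_left₀ hr0 hzhi 2
  unfold hGeom; push_cast
  rw [abs_le]
  constructor
  · have : ((ρbar : ℝ) - (189 / 200) ^ 2 * ((lloQ (Qint c) : ℝ) - 5 / 189) ^ 2) ≤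
        max ((199 / 200 : ℝ) ^ 2 * ((lupQ (Qint c) : ℝ) + 5 / 189) ^ 2 - ρbar)
          (ρbar - (189 / 200) ^ 2 * ((lloQ (Qint c) : ℝ) - 5 / 189) ^ 2) := le_max_right _ _
    nlinarith
  · have : ((199 / 200 : ℝ) ^ 2 * ((lupQ (Qint c) : ℝ) + 5 / 189) ^ 2 - ρbar) ≤
        max ((199 / 200 : ℝ) ^ 2 * ((lupQ (Qint c) : ℝ) + 5 / 189) ^ 2 - ρbar)
          (ρbar - (189 / 200) ^ 2 * ((lloQ (Qint c) : ℝ) - 5 / 189) ^ 2) := le_max_left _ _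
    nlinarith

section Validity

variable (hCI : ChartIdentities) (C : CellData) (A B : E3 →L[ℝ] E3) (δ : E3) (c : BondClass) (h : ℚ)
  (hth : |‖A (bondVec δ c)‖ ^ 2 - C.rhoc c| ≤ (h : ℝ))
  (hpos : 0 < ‖A (bondVec δ c)‖) {w : Label → E3} (hw : (support w).Finite)

include hCI hth hpos hw

/-- **validity of the ω-term:** a checked lower model (radius `h`) times the PSD direction form is below the true term. -/
theorem omegaTerm_le (P : UPoly) (hchk : nonnegDoubleRoot (omegaNum (C.rhoc c) P) h = true) :
    evalPPF (omegaTermPPF C c P) (chartX C A B δ) w ≤ omegaLJ ‖A (bondVec δ c)‖ * longForm δ c w := by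
  have ht : |spEval (rhoPoly C c) (chartX C A B δ)| ≤ h := by
    have := rho_eq hCI C A B δ c
    rwa [show spEval (rhoPoly C c) (chartX C A B δ) = ‖A (bondVec δ c)‖ ^ 2 - C.rhoc c by linarith]
  unfold omegaTermPPF
  rw [evalPPF_mulSP, spEval_ucompose, evalPPF_classPPF hw, matVal_LmatP, omegaLJ_eq_omegaT, rho_eq hCI C A B δ c,
    longForm_eq_pairEvalR hCI δ c w]
  refine mul_le_mul_of_nonneg_right ?_ (pairEvalR_outer_nonneg c _ w)
  refine model_le_omegaT hchk ht ?_
  rw [← rho_eq hCI C A B δ c]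
  positivity

end Validity

/-- Anchor of this support file (registered stub of the line skeleton). -/
theorem stub_certChart : ∀ (C : CellData) (A B : EuclideanSpace ℝ (Fin 3) →L[ℝ] EuclideanSpace ℝ (Fin 3))
    (δ : EuclideanSpace ℝ (Fin 3)) (i j : Fin 3), spEval (XP i j) (chartX C A B δ) = ghat A i j - C.G i j :=
  matVal_XP

end Summit.AtomisticToContinuum.Crystallization.Theorems.PhononStabilityCWC.Cert

end
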